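import Summits.CriticalPhenomena.SAWScalingLimit.Theorems.SAWReversalUpgradePathUpgradeRSLECont
import Summits.CriticalPhenomena.SAWScalingLimit.Theorems.SAWReversalUpgradePathUpgradeRSLEInj
import Summits.CriticalPhenomena.SAWScalingLimit.Theorems.SAWReversalUpgradePathUpgradeRSLEOsc
import Literature.Probability.RandomPlanarGeometry.ChordalReversibility
import HarnessLib

/-!
# Assembly phase `phase2b_fine` of `stub_returnsDie` — fine scales and windows
(crux `PathUpgradeR`, stmt-CriticalPhenomena-18055, route `SAWReversalUpgrade`, line `bidir_windows`)

Landing target: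
`Summits/CriticalPhenomena/SAWScalingLimit/Theorems/SAWReversalUpgradePathUpgradeRAsmFine.lean`
(`--supports stmt-CriticalPhenomena-18055`; registered anchor `stub_returnsDie_sqrtHalf`).

The proof of the registered stub `stub_returnsDie` (returns of the lattice curve die) compares the
lattice curve with the SLE(8/3) reference sample through a cascade of deterministic constants, each
chosen from an already-landed quantile lemma at budget `β`.  This file is ONE PHASE of that cascade,
the *fine* phase `PathUpgradeRAsm.phase2b_fine` (statement generated by the lead and consumed
positionally by the final assembly): given the coarse data `T, T', c₀, c₁, r₁, r₁'` of both
directions (forward instance `(D, φ)`, backward instance `(D.swap, φ')`) and a budget `β > 0`, it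
produces

* the oscillation meshes `τ, τ₁` (resp. `τ', τ₁'`) of the driving function `V = sleDriving (8/3) ω`
  at levels `√la / 200` and `ρ₁ / 2` on the horizon `T + 1` (resp. `T' + 1`) — `stub_sleOsc`;
* the scale `θ = min (τ/2, τ₁/2, r₁²/400, c₀/16, la/160000)` with `la = 1/2 = L · θ`, `L ≥ 2`,
  `√θ ≤ √la / 400`, `8 θ < c₀`, the return radius `ρ₁ = r₁ / 10` and the margin
  `m₁ = √la / 40 ≥ 1/64` (anchor `stub_returnsDie_sqrtHalf`), and the same primed family;
* the backward window `w' = min (θ'/4, c₁)` and its injectivity radius `μ'` — `stub_sleInj` on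
  `(D.swap, φ')`;
* the forward continuity modulus `cν` at level `ν = μ'/4` — `stub_sleCont` on `(D, φ)` —, the
  forward window `w = min (cν/2, θ/4, c₀/3, 1)` and its injectivity radius `μ` — `stub_sleInj`.

All seven probability bounds of the statement are literally the conclusions of the quantile lemmas
at these parameters; the remaining conjuncts are elementary inequalities between the constants
(`PathUpgradeRAsm.fine_exists_scale`, `PathUpgradeRAsm.fine_window`).
-/

noncomputable section

open scoped ENNReal NNReal
open Literature.Probability Literature.Probability.RandomPlanarGeometry

namespace Summit.CriticalPhenomena.SAWScalingLimit.Theorems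

/-- **Anchor** (registered stub `stub_returnsDie_sqrtHalf` of crux `PathUpgradeR`, line
`bidir_windows`): the margin `m₁ = √(1/2) / 40` of the fine phase is at least `1/64`, i.e.
`5/8 ≤ √(1/2)` (from `(5/8)² = 25/64 ≤ 1/2`). [folklore] -/
theorem stub_returnsDie_sqrtHalf : (1 : ℝ) / 64 ≤ Real.sqrt (1 / 2) / 40 := by
  have h : (5 : ℝ) / 8 ≤ Real.sqrt (1 / 2) := Real.le_sqrt_of_sq_le (by norm_num)
  linarith

namespace PathUpgradeRAsm

/-- Square roots at the fine scale: `θ ≤ (1/2) / 160000` gives `√θ ≤ √(1/2) / 400`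
(`√160000 = 400`). [folklore] -/
theorem fine_sqrt_le {θ : ℝ} (h : θ ≤ 1 / 2 / 160000) :
    Real.sqrt θ ≤ Real.sqrt (1 / 2) / 400 := by
  have h400 : Real.sqrt 160000 = 400 := by
    rw [show (160000 : ℝ) = 400 ^ 2 by norm_num, Real.sqrt_sq (by norm_num)]
  calc Real.sqrt θ ≤ Real.sqrt (1 / 2 / 160000) := Real.sqrt_le_sqrt h
    _ = Real.sqrt (1 / 2) / 400 := by rw [Real.sqrt_div' _ (by norm_num), h400]

/-- **The scale family of one direction.**  Given the two oscillation meshes `τ, τ₁ > 0`, the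
coarse window bound `c > 0` and the gate radius `r > 0`, the scale
`θ := min (min (τ/2) (τ₁/2)) (min (min (r²/400) (c/16)) ((1/2)/160000))` and `L := (1/2)/θ`
satisfy `0 < θ ≤ τ`, `2θ ≤ 1/2 = L θ`, `2 ≤ L`, `√θ ≤ √(1/2)/400`, `8θ < c`, `2θ ≤ τ₁`,
`2θ ≤ (r/10)²` and `θ ≤ c/16`. [folklore] -/
theorem fine_exists_scale {τ τ₁ c r : ℝ} (hτ : 0 < τ) (hτ₁ : 0 < τ₁) (hc : 0 < c) (hr : 0 < r) :
    ∃ θ L : ℝ, 0 < θ ∧ θ ≤ τ ∧ 2 * θ ≤ 1 / 2 ∧ (1 / 2 : ℝ) = L * θ ∧ 2 ≤ L ∧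
      Real.sqrt θ ≤ Real.sqrt (1 / 2) / 400 ∧ 8 * θ < c ∧ 2 * θ ≤ τ₁ ∧
      2 * θ ≤ (r / 10) ^ 2 ∧ θ ≤ c / 16 := by
  obtain ⟨θ, hθ, h1, h2, h3, h4, h5⟩ : ∃ θ : ℝ, 0 < θ ∧ θ ≤ τ / 2 ∧ θ ≤ τ₁ / 2 ∧
      θ ≤ r ^ 2 / 400 ∧ θ ≤ c / 16 ∧ θ ≤ 1 / 2 / 160000 :=
    ⟨min (min (τ / 2) (τ₁ / 2)) (min (min (r ^ 2 / 400) (c / 16)) (1 / 2 / 160000)),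
      by positivity, (min_le_left _ _).trans (min_le_left _ _),
      (min_le_left _ _).trans (min_le_right _ _),
      (min_le_right _ _).trans ((min_le_left _ _).trans (min_le_left _ _)),
      (min_le_right _ _).trans ((min_le_left _ _).trans (min_le_right _ _)),
      (min_le_right _ _).trans (min_le_right _ _)⟩
  refine ⟨θ, 1 / 2 / θ, hθ, by linarith, by linarith, (div_mul_cancel₀ _ hθ.ne').symm, ?_,
    fine_sqrt_le h5, by linarith, by linarith, ?_, h4⟩
  · rw [le_div_iff₀ hθ]
    linarith
  · rw [show (r / 10) ^ 2 = r ^ 2 / 100 by ring]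
    linarith

/-- **Window inequalities of one direction.**  If `4w ≤ θ`, `2θ ≤ τ₁`, `2θ ≤ (r/10)²`,
`1/2 = L θ` and `θ ≤ 1/16`, then `θ + 4w ≤ τ₁`, `5 (r/10 + √(θ + 4w)) ≤ r` and
`(L + 1) θ + w ≤ 1`. [folklore] -/
theorem fine_window {θ w τ₁ r L : ℝ} (hr : 0 < r) (h4w : 4 * w ≤ θ) (hθτ₁ : 2 * θ ≤ τ₁)
    (hθr : 2 * θ ≤ (r / 10) ^ 2) (hL : (1 / 2 : ℝ) = L * θ) (hθb : θ ≤ 1 / 16) :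
    θ + 4 * w ≤ τ₁ ∧ 5 * (r / 10 + Real.sqrt (θ + 4 * w)) ≤ r ∧ (L + 1) * θ + w ≤ 1 := by
  refine ⟨by linarith, ?_, ?_⟩
  · have h : θ + 4 * w ≤ (r / 10) ^ 2 := by linarith
    have h' := Real.sqrt_le_sqrt h
    rw [Real.sqrt_sq (by positivity)] at h'
    linarith
  · rw [show (L + 1) * θ + w = L * θ + θ + w by ring, ← hL]
    linarith

/-- **Fine phase of the constant cascade of `stub_returnsDie`** (crux `PathUpgradeR`, line
`bidir_windows`; statement generated by the lead, consumed positionally by the final assembly).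
For both directions (forward `(D, φ)` on the horizon `T + 1`, backward `(D.swap, φ')` on `T' + 1`)
and a budget `β > 0` it chooses the oscillation meshes `τ, τ₁, τ', τ₁'` (`stub_sleOsc`), the scales
`θ, θ'` with `la = la' = 1/2 = L θ = L' θ'`, the return radii `ρ₁ = r₁/10`, `ρ₁' = r₁'/10`, the
margins `m₁ = m₁' = √(1/2)/40 ≥ 1/64` (`stub_returnsDie_sqrtHalf`), the backward window `w'` with
injectivity radius `μ'` (`stub_sleInj`), the forward continuity modulus `cν` at level `ν = μ'/4`
(`stub_sleCont`) and the forward window `w` with injectivity radius `μ` (`stub_sleInj`), so that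
all the listed inequalities hold and each of the seven bad events has `P'`-measure `≤ β`.
[folklore] -/
theorem phase2b_fine : ∀ (D : Literature.Probability.RandomPlanarGeometry.DobrushinDomain) (φ : Literature.Probability.RandomPlanarGeometry.ConformalEquiv UpperHalfPlane.upperHalfPlaneSet D.carrier), D.IsChordalUniformizing φ → ∀ (φ' : Literature.Probability.RandomPlanarGeometry.ConformalEquiv UpperHalfPlane.upperHalfPlaneSet D.swap.carrier), D.swap.IsChordalUniformizing φ' → ∀ (T T' : NNReal), 0 < T → 0 < T' → ∀ (c₀ c₁ r₁ r₁' : ℝ), 0 < c₀ → c₀ ≤ 1 / 16 → 0 < c₁ → c₁ ≤ 1 / 16 → 0 < r₁ → 0 < r₁' → ∀ β : ENNReal, 0 < β → ∃ (τ τ₁ θ la L ρ₁ m₁ τ' τ₁' θ' la' L' ρ₁' m₁' w' μ' cν ν w μ : ℝ), (0 < τ) ∧ (0 < τ₁) ∧ (0 < θ) ∧ (θ ≤ τ) ∧ (la = 1 / 2) ∧ (2 * θ ≤ la) ∧ (la ≤ 1) ∧ (la = L * θ) ∧ (2 ≤ L) ∧ (Real.sqrt θ ≤ Real.sqrt la /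 400) ∧ (8 * θ < c₀) ∧ (ρ₁ = r₁ / 10) ∧ (0 < ρ₁) ∧ (m₁ = Real.sqrt la / 40) ∧ (1 / 64 ≤ m₁) ∧ (θ + 4 * w ≤ τ₁) ∧ (5 * (ρ₁ + Real.sqrt (θ + 4 * w)) ≤ r₁) ∧ ((L + 1) * θ + w ≤ 1) ∧ (0 < w) ∧ (w < θ / 2) ∧ (3 * w ≤ c₀) ∧ (w ≤ 1) ∧ (0 < τ') ∧ (0 < τ₁') ∧ (0 < θ') ∧ (θ' ≤ τ') ∧ (la' = 1 / 2) ∧ (2 * θ' ≤ la') ∧ (la' ≤ 1) ∧ (la' = L' * θ') ∧ (2 ≤ L') ∧ (Real.sqrt θ' ≤ Real.sqrt la' / 400) ∧ (8 * θ' < c₁) ∧ (ρ₁' = r₁' / 10) ∧ (0 < ρ₁') ∧ (m₁' = Real.sqrt la' / 40) ∧ (1 / 64 ≤ m₁') ∧ (θ' + 4 * w' ≤ τ₁') ∧ (5 * (ρ₁' + Real.sqrt (θ' + 4 * w')) ≤ r₁') ∧ ((L' + 1) * θ' + w' ≤ 1) ∧ (0 < w') ∧ (w' < θ' / 2) ∧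 (w' ≤ c₁) ∧ (0 < μ') ∧ (ν = μ' / 4) ∧ (0 < cν) ∧ (2 * w ≤ cν) ∧ (0 < μ) ∧ (Literature.Probability.Process.preWienerMeasure {ω | ∃ s s' : NNReal, (s : ℝ) ≤ T + 1 ∧ (s' : ℝ) ≤ T + 1 ∧ |(s : ℝ) - s'| ≤ τ ∧ Real.sqrt la / 200 < |Literature.Probability.RandomPlanarGeometry.sleDriving ((8:NNReal)/3) ω s - Literature.Probability.RandomPlanarGeometry.sleDriving ((8:NNReal)/3) ω s'|} ≤ β) ∧ (Literature.Probability.Process.preWienerMeasure {ω | ∃ s s' : NNReal, (s : ℝ) ≤ T + 1 ∧ (s' : ℝ) ≤ T + 1 ∧ |(s : ℝ) - s'| ≤ τ₁ ∧ ρ₁ / 2 < |Literature.Probability.RandomPlanarGeometry.sleDriving ((8:NNReal)/3) ω s - Literature.Probability.RandomPlanarGeometry.sleDriving ((8:NNReal)/3) ω s'|} ≤ β) ∧ (Literature.Probability.Process.preWienerMeasure {ω | ∃ s s' : NNReal, (s : ℝ) ≤ T' + 1 ∧ (s' : ℝ) ≤ T' + 1 ∧ |(s : ℝ) - s'| ≤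 τ' ∧ Real.sqrt la' / 200 < |Literature.Probability.RandomPlanarGeometry.sleDriving ((8:NNReal)/3) ω s - Literature.Probability.RandomPlanarGeometry.sleDriving ((8:NNReal)/3) ω s'|} ≤ β) ∧ (Literature.Probability.Process.preWienerMeasure {ω | ∃ s s' : NNReal, (s : ℝ) ≤ T' + 1 ∧ (s' : ℝ) ≤ T' + 1 ∧ |(s : ℝ) - s'| ≤ τ₁' ∧ ρ₁' / 2 < |Literature.Probability.RandomPlanarGeometry.sleDriving ((8:NNReal)/3) ω s - Literature.Probability.RandomPlanarGeometry.sleDriving ((8:NNReal)/3) ω s'|} ≤ β) ∧ (Literature.Probability.Process.preWienerMeasure {ω | ∃ s t : NNReal, (s : ℝ) ≤ T' + 1 ∧ (t : ℝ) ≤ T' + 1 ∧ w' ≤ |(s : ℝ) - t| ∧ dist (φ'.boundaryExtension (Literature.Probability.RandomPlanarGeometry.sleTrace ((8:NNReal)/3) ω s)) (φ'.boundaryExtension (Literature.Probability.RandomPlanarGeometry.sleTrace ((8:NNReal)/3) ω t)) < μ'} ≤ β) ∧ (Literature.Probability.Process.preWienerMeasure {ω | ∃ s t : NNReal, (s : ℝ)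 ≤ T + 1 ∧ (t : ℝ) ≤ T + 1 ∧ |(s : ℝ) - t| ≤ cν ∧ ν ≤ dist (φ.boundaryExtension (Literature.Probability.RandomPlanarGeometry.sleTrace ((8:NNReal)/3) ω s)) (φ.boundaryExtension (Literature.Probability.RandomPlanarGeometry.sleTrace ((8:NNReal)/3) ω t))} ≤ β) ∧ (Literature.Probability.Process.preWienerMeasure {ω | ∃ s t : NNReal, (s : ℝ) ≤ T + 1 ∧ (t : ℝ) ≤ T + 1 ∧ w ≤ |(s : ℝ) - t| ∧ dist (φ.boundaryExtension (Literature.Probability.RandomPlanarGeometry.sleTrace ((8:NNReal)/3) ω s)) (φ.boundaryExtension (Literature.Probability.RandomPlanarGeometry.sleTrace ((8:NNReal)/3) ω t)) < μ} ≤ β) := by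
  intro D φ hφ φ' hφ' T T' _hT _hT' c₀ c₁ r₁ r₁' hc₀ hc₀16 hc₁ hc₁16 hr₁ hr₁' β hβ
  -- forward meshes and scale
  obtain ⟨τ, hτ, hEτ⟩ := stub_sleOsc T (Real.sqrt (1 / 2) / 200) (by positivity) β hβ
  obtain ⟨τ₁, hτ₁, hEτ₁⟩ := stub_sleOsc T (r₁ / 10 / 2) (by positivity) β hβ
  obtain ⟨θ, L, hθ, hθτ, h2θ, hLθ, hL2, hsqθ, h8θ, hθτ₁, hθr, hθc⟩ :=
    fine_exists_scale hτ hτ₁ hc₀ hr₁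
  -- backward meshes and scale
  obtain ⟨τ', hτ', hEτ'⟩ := stub_sleOsc T' (Real.sqrt (1 / 2) / 200) (by positivity) β hβ
  obtain ⟨τ₁', hτ₁', hEτ₁'⟩ := stub_sleOsc T' (r₁' / 10 / 2) (by positivity) β hβ
  obtain ⟨θ', L', hθ', hθτ', h2θ', hLθ', hL2', hsqθ', h8θ', hθτ₁', hθr', hθc'⟩ :=
    fine_exists_scale hτ' hτ₁' hc₁ hr₁'
  -- backward window and injectivity radius
  obtain ⟨w', hw'θ, hw'c, hw'⟩ : ∃ w' : ℝ, w' ≤ θ' / 4 ∧ w' ≤ c₁ ∧ 0 < w' :=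
    ⟨min (θ' / 4) c₁, min_le_left _ _, min_le_right _ _, by positivity⟩
  obtain ⟨hW1', hW2', hW3'⟩ :=
    fine_window hr₁' (by linarith) hθτ₁' hθr' hLθ' (by linarith)
  obtain ⟨μ', hμ', hEμ'⟩ := stub_sleInj D.swap φ' hφ' T' w' hw' β hβ
  -- forward continuity modulus, window and injectivity radius
  obtain ⟨cν, hcν, hEcν⟩ := stub_sleCont D φ hφ T (μ' / 4) (by positivity) β hβ
  obtain ⟨w, hwcν, hwθ, hwc, hw1, hw⟩ :
      ∃ w : ℝ, w ≤ cν / 2 ∧ w ≤ θ / 4 ∧ w ≤ c₀ / 3 ∧ w ≤ 1 ∧ 0 < w :=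
    ⟨min (min (cν / 2) (θ / 4)) (min (c₀ / 3) 1), (min_le_left _ _).trans (min_le_left _ _),
      (min_le_left _ _).trans (min_le_right _ _), (min_le_right _ _).trans (min_le_left _ _),
      (min_le_right _ _).trans (min_le_right _ _), by positivity⟩
  obtain ⟨hW1, hW2, hW3⟩ :=
    fine_window hr₁ (by linarith) hθτ₁ hθr hLθ (by linarith)
  obtain ⟨μ, hμ, hEμ⟩ := stub_sleInj D φ hφ T w hw β hβ
  exact ⟨τ, τ₁, θ, 1 / 2, L, r₁ / 10, Real.sqrt (1 / 2) / 40, τ', τ₁', θ', 1 / 2, L', r₁' / 10,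
    Real.sqrt (1 / 2) / 40, w', μ', cν, μ' / 4, w, μ,
    hτ, hτ₁, hθ, hθτ, rfl, h2θ, by norm_num, hLθ, hL2, hsqθ, h8θ, rfl, by positivity, rfl,
    stub_returnsDie_sqrtHalf, hW1, hW2, hW3, hw, by linarith, by linarith, hw1,
    hτ', hτ₁', hθ', hθτ', rfl, h2θ', by norm_num, hLθ', hL2', hsqθ', h8θ', rfl, by positivity, rfl,
    stub_returnsDie_sqrtHalf, hW1', hW2', hW3', hw', by linarith, hw'c,
    hμ', rfl, hcν, by linarith, hμ, hEτ, hEτ₁, hEτ', hEτ₁', hEμ', hEcν, hEμ⟩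

end PathUpgradeRAsm

end Summit.CriticalPhenomena.SAWScalingLimit.Theorems

end
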